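import Summits.HubbardSuperconductivity.HubbardSuperconductivity.Theorems.KLProgrammeKLRegimeScaleZeroCovarianceTorusPeriodisation

/-!
# Route `KLProgramme`, crux K3 — engine-flow child (stmt-HubbardSuperconductivity-20437), stub (C) at `n = 0`, located item #22a «(C)-SCALE0-PT2»,
# layer (2a)(M), model half: OFF-SITE, the scale-0 covariance's frequency coefficients are `O(ω⁻²)` — the `1/ω` part is spatially local

Seat hubbard-kl-k3c5-p1 (g14; owner of #22a).  By p1 g19's D7 `gridCov_uvSymbolCT_apply_zero_one_eq_sum_freq` an entry of the scale-0 grid covariance is a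
finite Matsubara sum `Σ_i (1/(βL²))²·e^{iω_iΔτ}·a_i`, `a_i = Σ_{k⃗} χ_{k⃗}(z̄)·Ψ(βL², Λ₀; e_K(k⃗), ω_i)`.  Above the cutoff shell (`ω² > Λ²`) the UV weight is `1` and
`Ψ = c/(−iω + e) = c/(−iω) − c·e/((−iω)(−iω + e))`; the first term is `k⃗`-independent, so its character sum vanishes OFF SITE (`z̄ ≠ 0`, `sum_torusChar_left`), and the
second is `≤ |c|·B/ω²` termwise (`|e_K| ≤ B`).  Hence **`norm_sum_torusChar_mul_uvSymbolFn_le`**: `‖Σ_{k⃗} χ_{k⃗}(z̄)Ψ(c,Λ;e_K(k⃗),ω)‖ ≤ L²·|c|·B/ω²` for `z̄ ≠ 0`,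
`ω² > Λ²` — the hypothesis `‖G(ω)‖ ≤ A/ω²` of the generic window-truncation lemma `Literature.Analysis.Fourier.norm_fermionicMatsubaraSum_sub_window_le` (this seat,
`FermionicMatsubaraWindowTail`) with `A = B/β` in D7's normalisation (`norm_freqCoeff_scaleZero_le`), and the `b = 2` decay that D3's Poisson identity asks of `G`.

Proofs only; no definitions; nothing here asserts (C), any stub of 20437, K3 or superconductivity.
References: BGM 2006 §2.1 (2.3)–(2.4) [cite: BenfattoGiulianiMastropietro2006]; Salmhofer 1999 §4.2.5 (4.70) [cite: Salmhofer1999].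
-/

noncomputable section

namespace Summit.HubbardSuperconductivity.HubbardSuperconductivity.Theorems.KLRegimeSplit

set_option linter.dupNamespace false -- summit = problem name (single-conjunct summit), D-0017

open Real Finset Complex Literature.MathematicalPhysics.QuantumLattice Literature.Probability.LatticeModels

variable {L : ℕ} [NeZero L]

/-- **Above the shell the UV symbol is the bare resolvent**: `Ψ(c,Λ;e,ω) = c/(−i(ω+0) + e)` when `Λ² < ω²` (`0 < Λ`). -/
theorem uvSymbolFn_eq_resolvent_of_sq_lt {Λ : ℝ} (hΛ : 0 < Λ) (c e : ℝ) {ω : ℝ} (hω : Λ ^ 2 < ω ^ 2) :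
    uvSymbolFn c Λ e ω = (c : ℂ) / (-I * ((ω + 0 : ℝ) : ℂ) + (e : ℂ)) := by
  have h1 := (uvWeightFn_eq_one_of_gt hΛ (e := e) (ω := ω) (by nlinarith [sq_nonneg e])).1
  rw [uvSymbolFn, h1, Complex.ofReal_one, one_mul, resolventFn]

/-- The denominator above the shell: `‖−i(ω+0) + e‖ ≥ |ω|` and `≠ 0` (`ω ≠ 0`). -/
theorem abs_le_norm_resolventDen {ω : ℝ} (hω : ω ≠ 0) (e : ℝ) :
    |ω| ≤ ‖-I * ((ω + 0 : ℝ) : ℂ) + (e : ℂ)‖ ∧ -I * ((ω + 0 : ℝ) : ℂ) + (e : ℂ) ≠ 0 := by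
  have hre : (-I * ((ω + 0 : ℝ) : ℂ) + (e : ℂ)) = ⟨e, -ω⟩ := by
    apply Complex.ext <;> simp
  have hle : |ω| ≤ ‖-I * ((ω + 0 : ℝ) : ℂ) + (e : ℂ)‖ := by
    rw [hre]
    have h := Complex.abs_im_le_norm (⟨e, -ω⟩ : ℂ)
    simpa using h
  refine ⟨hle, fun h0 => ?_⟩
  rw [h0, norm_zero] at hle
  exact hω (abs_eq_zero.1 (le_antisymm hle (abs_nonneg ω)))

/-- **OFF SITE, THE FREQUENCY COEFFICIENT IS `O(ω⁻²)`**: for `z̄ ≠ 0`, `0 < Λ`, `Λ² < ω²` and a band bound `|e_K(k⃗)| ≤ B`: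
`‖Σ_{k⃗} χ_{k⃗}(z̄)·Ψ(c,Λ;e_K(k⃗),ω)‖ ≤ L²·|c|·B/ω²`. -/
theorem norm_sum_torusChar_mul_uvSymbolFn_le {Λ : ℝ} (hΛ : 0 < Λ) (c μ : ℝ) (K : TrigPolyC4v) {B : ℝ}
    (hB : ∀ kv : TorusSite 2 L, |nambuXiCT L μ K kv| ≤ B) {z : TorusSite 2 L} (hz : z ≠ 0) {ω : ℝ} (hω : Λ ^ 2 < ω ^ 2) :
    ‖∑ kv : TorusSite 2 L, torusChar kv z * uvSymbolFn c Λ (nambuXiCT L μ K kv) ω‖ ≤ (L : ℝ) ^ 2 * |c| * B / ω ^ 2 := by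
  have hω0 : ω ≠ 0 := by rintro rfl; nlinarith
  have hB0 : 0 ≤ B := (abs_nonneg _).trans (hB 0)
  set u : ℂ := -I * ((ω + 0 : ℝ) : ℂ) with hu
  have hun : ‖u‖ = |ω| := by rw [hu]; simp
  have hu0 : u ≠ 0 := by rw [← norm_ne_zero_iff, hun]; exact abs_ne_zero.2 hω0
  -- `Ψ = c/u − c·e/(u(u+e))` termwise
  have hsplit : ∀ kv : TorusSite 2 L, uvSymbolFn c Λ (nambuXiCT L μ K kv) ω =
      (c : ℂ) / u - (c : ℂ) * (nambuXiCT L μ K kv : ℂ) / (u * (u + (nambuXiCT L μ K kv : ℂ))) := by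
    intro kv
    obtain ⟨-, hne⟩ := abs_le_norm_resolventDen hω0 (nambuXiCT L μ K kv)
    rw [uvSymbolFn_eq_resolvent_of_sq_lt hΛ c _ hω, ← hu]
    rw [← hu] at hne
    field_simp
    ring
  simp_rw [hsplit, mul_sub, Finset.sum_sub_distrib]
  -- the local part vanishes off site
  have hloc : ∑ kv : TorusSite 2 L, torusChar kv z * ((c : ℂ) / u) = 0 := by
    rw [← Finset.sum_mul, sum_torusChar_left, if_neg hz, zero_mul]
  rw [hloc, zero_sub, norm_neg]
  -- the rest termwise
  have hterm : ∀ kv : TorusSite 2 L, ‖torusChar kv z * ((c : ℂ) * (nambuXiCT L μ K kv : ℂ) / (u * (u + (nambuXiCT L μ K kv : ℂ))))‖ ≤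
      |c| * B / ω ^ 2 := by
    intro kv
    obtain ⟨hle, hne⟩ := abs_le_norm_resolventDen hω0 (nambuXiCT L μ K kv)
    rw [← hu] at hle hne
    rw [norm_mul, norm_torusChar, one_mul, norm_div, norm_mul, norm_mul, Complex.norm_real, Complex.norm_real, Real.norm_eq_abs,
      Real.norm_eq_abs, hun]
    have hω2 : ω ^ 2 ≤ |ω| * ‖u + (nambuXiCT L μ K kv : ℂ)‖ := by
      rw [← sq_abs]; rw [sq]; exact mul_le_mul_of_nonneg_left hle (abs_nonneg ω)
    have hpos : 0 < |ω| * ‖u + (nambuXiCT L μ K kv : ℂ)‖ := lt_of_lt_of_le (by positivity) hω2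
    rw [div_le_div_iff₀ hpos (by positivity)]
    have h1 := hB kv
    have : |c| * |nambuXiCT L μ K kv| * ω ^ 2 ≤ |c| * B * ω ^ 2 := by gcongr
    calc |c| * |nambuXiCT L μ K kv| * ω ^ 2 ≤ |c| * B * ω ^ 2 := this
      _ ≤ |c| * B * (|ω| * ‖u + (nambuXiCT L μ K kv : ℂ)‖) := mul_le_mul_of_nonneg_left hω2 (by positivity)
  refine (norm_sum_le _ _).trans ((Finset.sum_le_sum fun kv _ => hterm kv).trans (le_of_eq ?_))
  rw [Finset.sum_const, Finset.card_univ, nsmul_eq_mul]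
  have hcard : (Fintype.card (TorusSite 2 L) : ℝ) = (L : ℝ) ^ 2 := by
    rw [Fintype.card_pi, Fin.prod_const, ZMod.card]; push_cast; ring
  rw [hcard]; ring

/-- **D7's frequency coefficient, off site**: with the normalisation of `gridCov_uvSymbolCT_apply_zero_one_eq_sum_freq` (`(1/(βL²))²` in front, `c = βL²` inside `Ψ`),
`‖(1/(βL²))²·Σ_{k⃗} χ_{k⃗}(z̄)Ψ(βL²,Λ;e_K,ω)‖ ≤ B/(β·ω²)` for `z̄ ≠ 0`, `Λ² < ω²` (`0 < β`) — `(1/β)·(B/ω²)`, the shape the window-truncation and Poisson lemmas read. -/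
theorem norm_freqCoeff_scaleZero_le {β : ℝ} (hβ : 0 < β) {Λ : ℝ} (hΛ : 0 < Λ) (μ : ℝ) (K : TrigPolyC4v) {B : ℝ}
    (hB : ∀ kv : TorusSite 2 L, |nambuXiCT L μ K kv| ≤ B) {z : TorusSite 2 L} (hz : z ≠ 0) {ω : ℝ} (hω : Λ ^ 2 < ω ^ 2) :
    ‖((1 / (β * (L : ℝ) ^ 2) : ℝ) : ℂ) ^ 2 * ∑ kv : TorusSite 2 L, torusChar kv z * uvSymbolFn (β * (L : ℝ) ^ 2) Λ (nambuXiCT L μ K kv) ω‖ ≤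
      B / (β * ω ^ 2) := by
  have hL : (0 : ℝ) < (L : ℝ) := by have := NeZero.ne L; positivity
  have h := norm_sum_torusChar_mul_uvSymbolFn_le (L := L) hΛ (β * (L : ℝ) ^ 2) μ K hB hz hω
  rw [norm_mul, norm_pow, Complex.norm_real, Real.norm_eq_abs, abs_of_pos (by positivity)]
  refine (mul_le_mul_of_nonneg_left h (by positivity)).trans (le_of_eq ?_)
  rw [abs_of_pos (by positivity)]
  field_simp

end Summit.HubbardSuperconductivity.HubbardSuperconductivity.Theorems.KLRegimeSplit

end
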